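import Summits.Parity.GeneralizedHardyLittlewood.Theorems.ZDegreeToeplitzBandLemma81ExtResidue
import Summits.Parity.GeneralizedHardyLittlewood.Theorems.ZDegreeToeplitzBandLemma81ExtKernelSwap
import Literature.NumberTheory.LFunctions.Zhang2022.Section8Lemma81FromProp22
import Literature.NumberTheory.LFunctions.Zhang2022.Section8Ded81
import Literature.NumberTheory.LFunctions.Zhang2022.KnifeEdgeLenLongLegSplit

/-!
# Route `ZDegreeToeplitzBand`, crux `PsiGradedTablesClosePoly` (stmt-Parity-22438), line `long_poly_dil`, stub
# `stub_lemma81LongPsiDil` (P2-Dil): the §8 Lemma 8.1 chain RE-RUN AT TWO INDEPENDENT TRUNCATIONS — Part 3,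
# Z22:§8.u015 with Cauchy–Schwarz and the assembly: LEMMA 8.1 FOR `lhs81Ext`/`Theta1Ext` MODULO the data's
# mean square on `𝔍(α)` (Z22:§8.u014) and the contour shift (Z22:§8.u016)

Y. Zhang, *Discrete mean estimates and the Landau–Siegel zero*, arXiv:2211.02515v1 — an unrefereed manuscript under
adjudication. **The programme SEARCHES and TYPES; no claim about Landau–Siegel zeros, Theorems 1–2 of arXiv:2211.02515
or a repaired Margin232 until a kernel theorem says so.**

`lemma81Ext_sum_kernel_swap_le`: Z22:§8.u015 ("These estimates together with (7.4) and (2.9) imply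
`Σ_{ψ∈Ψ₁}(Ĩ₁⁺ − I₁⁺) = o(𝔓)`") at two truncations, with the data's mean square `X` as a PARAMETER and Cauchy–Schwarz in
place of `2|LL||AA| ≤ |LL|²+|AA|²`: `Σ_{Ψ₁}|Ĩ⁺ − I⁺| ≤ C₂𝓛⁻¹¹⁴·√(C₃P²𝓛³⁶)·√X·2πe^{1/4}`.
`lemma81Ext_of_meanSquare_of_shift`: the whole chain — (8.1) + reflection (`…ExtResidue`), u012 (`…ExtKernelSwap`),
u013 (`Section8aStatements.step8u013_holds`, data-free), u015 (here), u017/the bookkeeping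
(`Ded81Edge.norm_sum_sub_le_of_steps`), `#Ψ₁ ≤ 𝔓 ≤ 4P²` — with TWO inputs left as hypotheses: the mean square bound `X`
for `Σ_{Ψ₁}|A_{N₁}(a₁;s)A_{N₂}(a₂;1−s)|²` on `𝔍(α)` (for the pair and its reflection) and the contour shift
`Σ_{Ψ₁}I⁺ = Θ₁Ext + O(e^{−𝓛¹⁰/16})`. Conclusion:
`‖lhs81Ext − (Theta1Ext + conj Theta1Ext′)‖ ≤ C·𝓛⁻⁹⁶·P·√X + 1` for all large `D`.
WHY THIS SHAPE (budget memo BUDGET-P2Dil-g20.md, evidence on stmt-Parity-22438): the printed Lemma 8.1 is the case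
`X = C·P²𝓛³⁶` (error `C·P²𝓛⁻⁷⁸ = o(𝔓)`, ONE power of 𝓛 to spare against `𝔓 ≍ P²𝓛⁻⁷⁷`); the slot P2-Dil needs
`X ≤ c·ε²·D·P²·𝓛³⁸`, which divisor-class heads of length `D⁴` do not supply — the surviving input is the mean square for the
cell's own lacunary heads under (A). Theorems only; no definitions; no new named facts. Prover: ls-knife-typer-3 g20 (cell
landau-siegel §D), `--supports` stmt-Parity-22438. [cite: Zhang2022LandauSiegel, §8 Lemma 8.1 pp. 42–44]
-/

noncomputable section

open Complex Real Set MeasureTheory ComplexConjugate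
open Literature.NumberTheory.LFunctions.Zhang2022
open Literature.NumberTheory.LFunctions.Zhang2022.Skeleton
open Literature.NumberTheory.LFunctions.Zhang2022.Section8aStatements
open Literature.NumberTheory.LFunctions.Zhang2022.Ded81Edge
open Literature.NumberTheory.LFunctions.Zhang2022.KnifeEdge.LongLegSplit

namespace Summit.Parity.GeneralizedHardyLittlewood.Theorems

/-! ### Z22:§8.u015 at two truncations, with the mean square as a parameter -/

/-- **Z22:§8.u015 AT TWO TRUNCATIONS, Cauchy–Schwarz form** (§8 p. 44 "These estimates together with (7.4) and (2.9)
imply …"): from the per-`ψ` kernel-swap bound `|Ĩ⁺−I⁺| ≤ C₂𝓛⁻¹¹⁴∫|L₂L₃·AĀω|`, the `L`-mean square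
`Σ_{Ψ₁}|L₂L₃|² ≤ C₃P²𝓛³⁶` and a data mean square `Σ_{Ψ₁}|A_{N₁}(a₁;s)A_{N₂}(a₂;1−s)|² ≤ X` along `𝔍(α)`:
`Σ_{Ψ₁}|Ĩ⁺ − I⁺| ≤ C₂𝓛⁻¹¹⁴·(√(C₃P²𝓛³⁶)·√X·2πe^{1/4})` (pointwise `Σ|LL||AA| ≤ √Σ|LL|²·√Σ|AA|²`, interchange of `Σ_ψ`
and `∫`, (7.4) `∫_{𝔍(α)}|ω||ds| ≤ 2πe^{1/4}`). [cite: Zhang2022LandauSiegel, §8 p. 44; §7 (7.4)] -/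
theorem lemma81Ext_sum_kernel_swap_le (c' : ℝ) {D : ℕ} [NeZero D] (χ : DirichletCharacter ℂ D)
    (N₁ N₂ : ℕ) (a₁ a₂ : ℕ → ℂ) {C₂ C₃ X : ℝ} (hC₂ : 0 ≤ C₂)
    (hℓ₁ : 0 ≤ ell1 D) (hℓ₂ : 0 < ell2 D) (hαℓ : |alpha D| ≤ ell2 D)
    (hΔ : ∀ x ∈ finsetOf (PsiOne χ),
      ‖Lemma81.segInt (t0 D) (ell1 D) ((alpha D : ℝ) : ℂ) (fun s => calCt c' x s *
            (Lemma81.dirPoly N₁ a₁ x.ψ s * Lemma81.dirPoly N₂ a₂ x.ψ⁻¹ (1 - s) * omegaW D s)) -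
          Lemma81.segInt (t0 D) (ell1 D) ((alpha D : ℝ) : ℂ) (fun s =>
            frakcW c' x s * Lemma81.dirPoly N₁ a₁ x.ψ s * Lemma81.dirPoly N₂ a₂ x.ψ⁻¹ (1 - s) * omegaW D s)‖ ≤
        C₂ * (ell D ^ 114)⁻¹ * ∫ v in (-ell1 D)..ell1 D,
          ‖x.ψ.LFunction (((alpha D : ℝ) : ℂ) + s0 D + v * I + beta2 c' D) *
              x.ψ.LFunction (((alpha D : ℝ) : ℂ) + s0 D + v * I + beta3 c' D) *
            (Lemma81.dirPoly N₁ a₁ x.ψ (((alpha D : ℝ) : ℂ) + s0 D + v * I) *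
              Lemma81.dirPoly N₂ a₂ x.ψ⁻¹ (1 - (((alpha D : ℝ) : ℂ) + s0 D + v * I)) *
              omegaW D (((alpha D : ℝ) : ℂ) + s0 D + v * I))‖)
    (hL : ∀ v ∈ Icc (-ell1 D) (ell1 D),
      ∑ x ∈ finsetOf (PsiOne χ),
        ‖x.ψ.LFunction (((alpha D : ℝ) : ℂ) + s0 D + v * I + beta2 c' D) *
            x.ψ.LFunction (((alpha D : ℝ) : ℂ) + s0 D + v * I + beta3 c' D)‖ ^ 2 ≤
        C₃ * bigP D ^ 2 * ell D ^ 36)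
    (hA : ∀ v ∈ Icc (-ell1 D) (ell1 D),
      ∑ x ∈ finsetOf (PsiOne χ),
        ‖Lemma81.dirPoly N₁ a₁ x.ψ (((alpha D : ℝ) : ℂ) + s0 D + v * I) *
            Lemma81.dirPoly N₂ a₂ x.ψ⁻¹ (1 - (((alpha D : ℝ) : ℂ) + s0 D + v * I))‖ ^ 2 ≤ X) :
    ∑ x ∈ finsetOf (PsiOne χ),
      ‖Lemma81.segInt (t0 D) (ell1 D) ((alpha D : ℝ) : ℂ) (fun s => calCt c' x s *
            (Lemma81.dirPoly N₁ a₁ x.ψ s * Lemma81.dirPoly N₂ a₂ x.ψ⁻¹ (1 - s) * omegaW D s)) -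
          Lemma81.segInt (t0 D) (ell1 D) ((alpha D : ℝ) : ℂ) (fun s =>
            frakcW c' x s * Lemma81.dirPoly N₁ a₁ x.ψ s * Lemma81.dirPoly N₂ a₂ x.ψ⁻¹ (1 - s) * omegaW D s)‖ ≤
      C₂ * (ell D ^ 114)⁻¹ *
        (Real.sqrt (C₃ * bigP D ^ 2 * ell D ^ 36) * Real.sqrt X * (2 * π * Real.exp (1 / 4))) := by
  -- the running point `s = α + s₀ + iv` of `𝔍(α)`
  set pt : ℝ → ℂ := fun v => ((alpha D : ℝ) : ℂ) + s0 D + v * I with hpt_def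
  have hpt : Continuous pt := by rw [hpt_def]; fun_prop
  -- the dominating function
  set G : ℝ → ℝ := fun v => Real.sqrt (C₃ * bigP D ^ 2 * ell D ^ 36) * Real.sqrt X * ‖omegaW D (pt v)‖
    with hG_def
  have hωc : Continuous fun v => omegaW D (pt v) := (continuous_omega _ _).comp hpt
  have hGc : Continuous G := continuous_const.mul hωc.norm
  have hc : 0 ≤ C₂ * (ell D ^ 114)⁻¹ :=
    mul_nonneg hC₂ (inv_nonneg.mpr ((by decide : Even 114).pow_nonneg _))
  -- continuity of the integrands
  have hg : ∀ x ∈ finsetOf (PsiOne χ), Continuous fun v =>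
      ‖x.ψ.LFunction (pt v + beta2 c' D) * x.ψ.LFunction (pt v + beta3 c' D) *
        (Lemma81.dirPoly N₁ a₁ x.ψ (pt v) * Lemma81.dirPoly N₂ a₂ x.ψ⁻¹ (1 - pt v) * omegaW D (pt v))‖ := by
    intro x _
    refine Continuous.norm ?_
    have h2 : Continuous fun v => x.ψ.LFunction (pt v + beta2 c' D) :=
      (continuous_LFunction_chr x).comp (hpt.add continuous_const)
    have h3 : Continuous fun v => x.ψ.LFunction (pt v + beta3 c' D) :=
      (continuous_LFunction_chr x).comp (hpt.add continuous_const)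
    exact (h2.mul h3).mul (lemma81Ext_continuous_AAω x N₁ N₂ a₁ a₂)
  -- pointwise domination on the segment (Cauchy–Schwarz over `Ψ₁`)
  have hle : ∀ v ∈ Icc (-ell1 D) (ell1 D), ∑ x ∈ finsetOf (PsiOne χ),
      ‖x.ψ.LFunction (pt v + beta2 c' D) * x.ψ.LFunction (pt v + beta3 c' D) *
        (Lemma81.dirPoly N₁ a₁ x.ψ (pt v) * Lemma81.dirPoly N₂ a₂ x.ψ⁻¹ (1 - pt v) * omegaW D (pt v))‖ ≤
        G v := by
    intro v hv
    have hterm : ∀ x ∈ finsetOf (PsiOne χ),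
        ‖x.ψ.LFunction (pt v + beta2 c' D) * x.ψ.LFunction (pt v + beta3 c' D) *
          (Lemma81.dirPoly N₁ a₁ x.ψ (pt v) * Lemma81.dirPoly N₂ a₂ x.ψ⁻¹ (1 - pt v) * omegaW D (pt v))‖ =
        (‖x.ψ.LFunction (pt v + beta2 c' D) * x.ψ.LFunction (pt v + beta3 c' D)‖ *
          ‖Lemma81.dirPoly N₁ a₁ x.ψ (pt v) * Lemma81.dirPoly N₂ a₂ x.ψ⁻¹ (1 - pt v)‖) * ‖omegaW D (pt v)‖ := by
      intro x _
      simp only [norm_mul]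
      ring
    rw [Finset.sum_congr rfl hterm, ← Finset.sum_mul]
    have hCS := Real.sum_mul_le_sqrt_mul_sqrt (finsetOf (PsiOne χ))
      (fun x => ‖x.ψ.LFunction (pt v + beta2 c' D) * x.ψ.LFunction (pt v + beta3 c' D)‖)
      (fun x => ‖Lemma81.dirPoly N₁ a₁ x.ψ (pt v) * Lemma81.dirPoly N₂ a₂ x.ψ⁻¹ (1 - pt v)‖)
    have h1 : Real.sqrt (∑ x ∈ finsetOf (PsiOne χ),
        ‖x.ψ.LFunction (pt v + beta2 c' D) * x.ψ.LFunction (pt v + beta3 c' D)‖ ^ 2) ≤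
        Real.sqrt (C₃ * bigP D ^ 2 * ell D ^ 36) := Real.sqrt_le_sqrt (hL v hv)
    have h2 : Real.sqrt (∑ x ∈ finsetOf (PsiOne χ),
        ‖Lemma81.dirPoly N₁ a₁ x.ψ (pt v) * Lemma81.dirPoly N₂ a₂ x.ψ⁻¹ (1 - pt v)‖ ^ 2) ≤ Real.sqrt X :=
      Real.sqrt_le_sqrt (hA v hv)
    have h12 := mul_le_mul h1 h2 (Real.sqrt_nonneg _) (Real.sqrt_nonneg _)
    exact mul_le_mul_of_nonneg_right (hCS.trans h12) (norm_nonneg _)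
  -- the abstract interchange-and-dominate lemma
  have key := sum_le_mul_integral_of_pointwise (finsetOf (PsiOne χ))
    (fun x => ‖Lemma81.segInt (t0 D) (ell1 D) ((alpha D : ℝ) : ℂ) (fun s => calCt c' x s *
            (Lemma81.dirPoly N₁ a₁ x.ψ s * Lemma81.dirPoly N₂ a₂ x.ψ⁻¹ (1 - s) * omegaW D s)) -
          Lemma81.segInt (t0 D) (ell1 D) ((alpha D : ℝ) : ℂ) (fun s =>
            frakcW c' x s * Lemma81.dirPoly N₁ a₁ x.ψ s * Lemma81.dirPoly N₂ a₂ x.ψ⁻¹ (1 - s) * omegaW D s)‖)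
    (fun x v => ‖x.ψ.LFunction (pt v + beta2 c' D) * x.ψ.LFunction (pt v + beta3 c' D) *
        (Lemma81.dirPoly N₁ a₁ x.ψ (pt v) * Lemma81.dirPoly N₂ a₂ x.ψ⁻¹ (1 - pt v) * omegaW D (pt v))‖)
    G (by linarith : -ell1 D ≤ ell1 D) hc hΔ hg hGc hle
  -- (7.4)
  have h74 : ∫ v in (-ell1 D)..ell1 D, ‖omegaW D (pt v)‖ ≤ 2 * π * Real.exp (1 / 4) :=
    SmoothWeight.integral_norm_omega_segment_le_of_abs_le hℓ₂ (t0 D) hαℓ hℓ₁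
  have hGint : ∫ v in (-ell1 D)..ell1 D, G v =
      Real.sqrt (C₃ * bigP D ^ 2 * ell D ^ 36) * Real.sqrt X * ∫ v in (-ell1 D)..ell1 D, ‖omegaW D (pt v)‖ :=
    intervalIntegral.integral_const_mul _ _
  refine key.trans ?_
  rw [hGint]
  exact mul_le_mul_of_nonneg_left (mul_le_mul_of_nonneg_left h74 (by positivity)) hc

/-! ### The assembly: Lemma 8.1 at two truncations, modulo the mean square and the contour shift -/

/-- `√(C·P²·𝓛³⁶) = √C·P·𝓛¹⁸` and `𝓛⁻¹¹⁴·(P𝓛¹⁸) = P·𝓛⁻⁹⁶` (`P > 0`, `𝓛 ≥ 1`). [folklore] -/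
theorem lemma81Ext_sqrt_budget {C : ℝ} (hC : 0 ≤ C) {D : ℕ} (hℓ : 1 ≤ ell D) :
    (ell D ^ 114)⁻¹ * Real.sqrt (C * bigP D ^ 2 * ell D ^ 36) = Real.sqrt C * ((ell D ^ 96)⁻¹ * bigP D) := by
  have hP : 0 ≤ bigP D := (Real.exp_pos _).le
  have hℓ0 : 0 < ell D := by linarith
  have h1 : C * bigP D ^ 2 * ell D ^ 36 = C * (bigP D * ell D ^ 18) ^ 2 := by ring
  rw [h1, Real.sqrt_mul hC, Real.sqrt_sq (by positivity)]
  field_simp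

variable {c' : ℝ}

/-- **LEMMA 8.1 AT TWO INDEPENDENT TRUNCATIONS, MODULO THE DATA MEAN SQUARE AND THE CONTOUR SHIFT.** For `c′ ≥ 0`
with `Prop22 c′`, and given the contour-shift input (Z22:§8.u016 at two truncations, hypothesis `hshift`), there is `C`
such that for all large `D`, under (A): for all truncations `N₁, N₂ ≤ P³`, coefficients `|a₁|, |a₂| ≤ P¹⁰` and every
real `X` bounding `Σ_{Ψ₁}|A_{N₁}(a₁;s)A_{N₂}(a₂;1−s)|²` and `Σ_{Ψ₁}|A_{N₂}(ā₂;s)A_{N₁}(ā₁;1−s)|²` along `𝔍(α)`,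
`‖lhs81Ext c′ χ N₁ N₂ a₁ a₂ − (Theta1Ext c′ χ N₁ N₂ a₁ a₂ + conj Theta1Ext c′ χ N₂ N₁ ā₂ ā₁)‖ ≤ C·𝓛⁻⁹⁶·P·√X + 1`.
Steps: (8.1)+reflection (`lemma81Ext_residue_edge`, `lemma81Ext_reflection`), u012 (`lemma81Ext_kernel_swap`), u013
(`step8u013_holds`), u015 (`lemma81Ext_sum_kernel_swap_le`), the bookkeeping `Ded81Edge.norm_sum_sub_le_of_steps`,
`#Ψ₁ ≤ 𝔓 ≤ 4P²` and `e^{2𝓛⁹}e^{−𝓛¹⁰/8} ≤ e^{−𝓛¹⁰/16}`. The printed Lemma 8.1 is the case `X = C·P²𝓛³⁶`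
(`Ded81Edge.step8u014_body`). [cite: Zhang2022LandauSiegel, §8 Lemma 8.1 pp. 42–44] -/
theorem lemma81Ext_of_meanSquare_of_shift (hc' : 0 ≤ c') (h22 : Prop22 c')
    (hshift : ForAllLarge fun D _ χ => AssumptionA D χ → ∀ (N₁ N₂ : ℕ) (a₁ a₂ : ℕ → ℂ),
      (N₁ : ℝ) ≤ bigP D ^ 3 → (N₂ : ℝ) ≤ bigP D ^ 3 →
      (∀ n, ‖a₁ n‖ ≤ bigP D ^ 10) → (∀ n, ‖a₂ n‖ ≤ bigP D ^ 10) →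
        ‖(∑ x ∈ finsetOf (PsiOne χ), Lemma81.segInt (t0 D) (ell1 D) ((alpha D : ℝ) : ℂ) (fun s =>
              frakcW c' x s * Lemma81.dirPoly N₁ a₁ x.ψ s * Lemma81.dirPoly N₂ a₂ x.ψ⁻¹ (1 - s) * omegaW D s)) -
            Theta1Ext c' χ N₁ N₂ a₁ a₂‖ ≤ Real.exp (-(1 / 16) * ell D ^ 10)) :
    ∃ C : ℝ, ForAllLarge fun D _ χ => AssumptionA D χ →
      ∀ (N₁ N₂ : ℕ) (a₁ a₂ : ℕ → ℂ) (X : ℝ), (N₁ : ℝ) ≤ bigP D ^ 3 → (N₂ : ℝ) ≤ bigP D ^ 3 →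
      (∀ n, ‖a₁ n‖ ≤ bigP D ^ 10) → (∀ n, ‖a₂ n‖ ≤ bigP D ^ 10) →
      (∀ v ∈ Icc (-ell1 D) (ell1 D), ∑ x ∈ finsetOf (PsiOne χ),
          ‖Lemma81.dirPoly N₁ a₁ x.ψ (((alpha D : ℝ) : ℂ) + s0 D + v * I) *
              Lemma81.dirPoly N₂ a₂ x.ψ⁻¹ (1 - (((alpha D : ℝ) : ℂ) + s0 D + v * I))‖ ^ 2 ≤ X) →
      (∀ v ∈ Icc (-ell1 D) (ell1 D), ∑ x ∈ finsetOf (PsiOne χ),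
          ‖Lemma81.dirPoly N₂ (fun n => conj (a₂ n)) x.ψ (((alpha D : ℝ) : ℂ) + s0 D + v * I) *
              Lemma81.dirPoly N₁ (fun n => conj (a₁ n)) x.ψ⁻¹ (1 - (((alpha D : ℝ) : ℂ) + s0 D + v * I))‖ ^ 2 ≤ X) →
        ‖lhs81Ext c' χ N₁ N₂ a₁ a₂ -
            (Theta1Ext c' χ N₁ N₂ a₁ a₂ +
              conj (Theta1Ext c' χ N₂ N₁ (fun n => conj (a₂ n)) fun n => conj (a₁ n)))‖ ≤
          C * ((ell D ^ 96)⁻¹ * bigP D) * Real.sqrt X + 1 := by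
  obtain ⟨C₁, h81⟩ := lemma81Ext_residue_edge hc' h22
  have hrefl := lemma81Ext_reflection c'
  obtain ⟨C₂, hΔ⟩ := lemma81Ext_kernel_swap hc' h22
  obtain ⟨C₃, hL⟩ := step8u013_holds c'
  obtain ⟨D₁, hD₁⟩ := exists_params_large c'
  obtain ⟨D₂, hfrakP⟩ := Step8u016.frakP_le_eventually
  obtain ⟨D₃, hD₃⟩ := exists_large_exp_le (4 * max C₁ 0) (1 / 16) (1 / 2) (by norm_num) (by norm_num)
  obtain ⟨D₄, hD₄⟩ := exists_large_exp_le 2 (1 / 16) (1 / 2) (by norm_num) (by norm_num)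
  obtain ⟨D₅, hD₅⟩ := Skeleton.exists_nat_forall_le_ell 32
  obtain ⟨D₆, hD₆⟩ := (((h81.and hrefl).and hΔ).and hL).and hshift
  set K : ℝ := max C₂ 0 * (Real.sqrt (max C₃ 0) * (2 * π * Real.exp (1 / 4))) with hK
  refine ⟨2 * K, max (max (max D₁ D₂) (max D₃ D₄)) (max D₅ D₆), ?_⟩
  intro D _ χ hD hq hp hA N₁ N₂ a₁ a₂ X hN₁ hN₂ ha₁ ha₂ hXA hXB
  have hDa : max (max D₁ D₂) (max D₃ D₄) ≤ D := le_trans (le_max_left _ _) hD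
  have hDb : max D₅ D₆ ≤ D := le_trans (le_max_right _ _) hD
  obtain ⟨hL1, hb1, hb2, hb3, hℓt, hαℓ, hℓ₁, hℓ₂, hα0⟩ :=
    hD₁ D (le_trans (le_trans (le_max_left _ _) (le_max_left _ _)) hDa)
  have hP4 := hfrakP D (le_trans (le_trans (le_max_right _ _) (le_max_left _ _)) hDa) hL1
  have hD3 := hD₃ D (le_trans (le_trans (le_max_left _ _) (le_max_right _ _)) hDa)
  have hD4 := hD₄ D (le_trans (le_trans (le_max_right _ _) (le_max_right _ _)) hDa)
  have h32 : (32 : ℝ) ≤ ell D := hD₅ D (le_trans (le_max_left _ _) hDb)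
  obtain ⟨⟨⟨⟨h81D, hreflD⟩, hΔD⟩, hLD⟩, hshiftD⟩ := hD₆ D χ (le_trans (le_max_right _ _) hDb) hq hp
  -- the conjugated, swapped data obey the same bounds
  have ha₂c : ∀ n, ‖conj (a₂ n)‖ ≤ bigP D ^ 10 := fun n => by rw [Complex.norm_conj]; exact ha₂ n
  have ha₁c : ∀ n, ‖conj (a₁ n)‖ ≤ bigP D ^ 10 := fun n => by rw [Complex.norm_conj]; exact ha₁ n
  -- the left side as `Σ_{ψ∈Ψ₁}` of the zero sums
  have hlhs : lhs81Ext c' χ N₁ N₂ a₁ a₂ = ∑ x ∈ finsetOf (PsiOne χ), ∑ ρ ∈ finsetOf (zeroSet D x),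
      cstar c' D x ρ * Lemma81.dirPoly N₁ a₁ x.ψ ρ * Lemma81.dirPoly N₂ a₂ x.ψ⁻¹ (1 - ρ) * omegaW D ρ := by
    unfold lhs81Ext idx
    rw [Finset.sum_sigma]
  rw [hlhs]
  have hmem : ∀ v ∈ Icc (-ell1 D) (ell1 D), onJ D (alpha D) (((alpha D : ℝ) : ℂ) + s0 D + v * I) :=
    fun v hv => ⟨v, abs_le.mpr ⟨by linarith [hv.1], hv.2⟩, rfl⟩
  have h114 : 0 ≤ (ell D ^ 114)⁻¹ := inv_nonneg.mpr ((by decide : Even 114).pow_nonneg _)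
  -- the `ℓ¹` bound over `Ψ₁` for `Ĩ⁺ − I⁺`, for a pair `(b₁,b₂;M₁,M₂)` with mean square `≤ X`
  have hI : ∀ (M₁ M₂ : ℕ) (b₁ b₂ : ℕ → ℂ),
      (∀ v ∈ Icc (-ell1 D) (ell1 D), ∑ x ∈ finsetOf (PsiOne χ),
          ‖Lemma81.dirPoly M₁ b₁ x.ψ (((alpha D : ℝ) : ℂ) + s0 D + v * I) *
              Lemma81.dirPoly M₂ b₂ x.ψ⁻¹ (1 - (((alpha D : ℝ) : ℂ) + s0 D + v * I))‖ ^ 2 ≤ X) →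
      ∑ x ∈ finsetOf (PsiOne χ),
        ‖Lemma81.segInt (t0 D) (ell1 D) ((alpha D : ℝ) : ℂ) (fun s => calCt c' x s *
              (Lemma81.dirPoly M₁ b₁ x.ψ s * Lemma81.dirPoly M₂ b₂ x.ψ⁻¹ (1 - s) * omegaW D s)) -
            Lemma81.segInt (t0 D) (ell1 D) ((alpha D : ℝ) : ℂ) (fun s =>
              frakcW c' x s * Lemma81.dirPoly M₁ b₁ x.ψ s * Lemma81.dirPoly M₂ b₂ x.ψ⁻¹ (1 - s) * omegaW D s)‖ ≤
        max C₂ 0 * (ell D ^ 114)⁻¹ *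
          (Real.sqrt (max C₃ 0 * bigP D ^ 2 * ell D ^ 36) * Real.sqrt X * (2 * π * Real.exp (1 / 4))) := by
    intro M₁ M₂ b₁ b₂ hXb
    refine lemma81Ext_sum_kernel_swap_le c' χ M₁ M₂ b₁ b₂ (le_max_right _ _) hℓ₁ hℓ₂ hαℓ ?_ ?_ hXb
    · intro x hx
      refine (hΔD hA x (mem_of_mem_finsetOf hx) M₁ M₂ b₁ b₂).trans ?_
      have hint : 0 ≤ ∫ v in (-ell1 D)..ell1 D,
          ‖x.ψ.LFunction (((alpha D : ℝ) : ℂ) + s0 D + v * I + beta2 c' D) *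
              x.ψ.LFunction (((alpha D : ℝ) : ℂ) + s0 D + v * I + beta3 c' D) *
            (Lemma81.dirPoly M₁ b₁ x.ψ (((alpha D : ℝ) : ℂ) + s0 D + v * I) *
              Lemma81.dirPoly M₂ b₂ x.ψ⁻¹ (1 - (((alpha D : ℝ) : ℂ) + s0 D + v * I)) *
              omegaW D (((alpha D : ℝ) : ℂ) + s0 D + v * I))‖ :=
        intervalIntegral.integral_nonneg (by linarith) fun v _ => norm_nonneg _
      exact mul_le_mul_of_nonneg_right (mul_le_mul_of_nonneg_right (le_max_left _ _) h114) hint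
    · intro v hv
      exact (hLD hA _ (hmem v hv)).trans (by gcongr; exact le_max_left _ _)
  -- the abstract bookkeeping
  have he₁ : 0 ≤ Real.exp (-(ell D ^ 10 / 8)) := (Real.exp_pos _).le
  have main := norm_sum_sub_le_of_steps (finsetOf (PsiOne χ))
    (fun x => ∑ ρ ∈ finsetOf (zeroSet D x),
      cstar c' D x ρ * Lemma81.dirPoly N₁ a₁ x.ψ ρ * Lemma81.dirPoly N₂ a₂ x.ψ⁻¹ (1 - ρ) * omegaW D ρ)
    (fun x => Lemma81.segInt (t0 D) (ell1 D) ((alpha D : ℝ) : ℂ) (fun s => calCt c' x s *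
      (Lemma81.dirPoly N₁ a₁ x.ψ s * Lemma81.dirPoly N₂ a₂ x.ψ⁻¹ (1 - s) * omegaW D s)))
    (fun x => Lemma81.segInt (t0 D) (ell1 D) ((-alpha D : ℝ) : ℂ) (fun s => calCt c' x s *
      (Lemma81.dirPoly N₁ a₁ x.ψ s * Lemma81.dirPoly N₂ a₂ x.ψ⁻¹ (1 - s) * omegaW D s)))
    (fun x => Lemma81.segInt (t0 D) (ell1 D) ((alpha D : ℝ) : ℂ) (fun s => calCt c' x s *
      (Lemma81.dirPoly N₂ (fun n => conj (a₂ n)) x.ψ s *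
        Lemma81.dirPoly N₁ (fun n => conj (a₁ n)) x.ψ⁻¹ (1 - s) * omegaW D s)))
    (fun x => Lemma81.segInt (t0 D) (ell1 D) ((alpha D : ℝ) : ℂ) (fun s =>
      frakcW c' x s * Lemma81.dirPoly N₁ a₁ x.ψ s * Lemma81.dirPoly N₂ a₂ x.ψ⁻¹ (1 - s) * omegaW D s))
    (fun x => Lemma81.segInt (t0 D) (ell1 D) ((alpha D : ℝ) : ℂ) (fun s =>
      frakcW c' x s * Lemma81.dirPoly N₂ (fun n => conj (a₂ n)) x.ψ s *
        Lemma81.dirPoly N₁ (fun n => conj (a₁ n)) x.ψ⁻¹ (1 - s) * omegaW D s))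
    (Theta1Ext c' χ N₁ N₂ a₁ a₂) (Theta1Ext c' χ N₂ N₁ (fun n => conj (a₂ n)) fun n => conj (a₁ n))
    (e₁ := max C₁ 0 * Real.exp (-(ell D ^ 10 / 8)))
    (e₂ := max C₂ 0 * (ell D ^ 114)⁻¹ *
      (Real.sqrt (max C₃ 0 * bigP D ^ 2 * ell D ^ 36) * Real.sqrt X * (2 * π * Real.exp (1 / 4))))
    (e₃ := Real.exp (-(1 / 16) * ell D ^ 10))
    (fun x hx => (h81D hA x (mem_of_mem_finsetOf hx) N₁ N₂ a₁ a₂ hN₁ hN₂ ha₁ ha₂).trans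
      (mul_le_mul_of_nonneg_right (le_max_left _ _) he₁))
    (fun x _ => hreflD x N₁ N₂ a₁ a₂)
    (hI N₁ N₂ a₁ a₂ hXA) (hI N₂ N₁ _ _ hXB)
    (hshiftD hA N₁ N₂ a₁ a₂ hN₁ hN₂ ha₁ ha₂)
    (hshiftD hA N₂ N₁ _ _ hN₂ hN₁ ha₂c ha₁c)
  refine main.trans ?_
  -- the budget: `#Ψ₁·e₁ ≤ ½`, `2e₂ = 2K·𝓛⁻⁹⁶·P·√X`, `2e₃ ≤ ½`
  have hcard : ((finsetOf (PsiOne χ)).card : ℝ) ≤ 4 * bigP D ^ 2 :=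
    (card_finsetOf_psiOne_le_frakP χ).trans hP4
  have hP : bigP D = Real.exp (ell D ^ 9) := rfl
  have b1 : ((finsetOf (PsiOne χ)).card : ℝ) * (max C₁ 0 * Real.exp (-(ell D ^ 10 / 8))) ≤ 1 / 2 := by
    have h2 : 4 * bigP D ^ 2 * Real.exp (-(ell D ^ 10 / 8)) ≤ 4 * Real.exp (-(1 / 16) * ell D ^ 10) := by
      have e : bigP D ^ 2 * Real.exp (-(ell D ^ 10 / 8)) = Real.exp (2 * ell D ^ 9 + -(ell D ^ 10 / 8)) := by
        rw [hP, ← Real.exp_nat_mul, ← Real.exp_add]; norm_num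
      rw [mul_assoc, e]
      refine mul_le_mul_of_nonneg_left (Real.exp_le_exp.mpr ?_) (by norm_num)
      have h9 : 0 ≤ ell D ^ 9 := by positivity
      have h10 : ell D ^ 10 = ell D * ell D ^ 9 := by ring
      nlinarith
    calc ((finsetOf (PsiOne χ)).card : ℝ) * (max C₁ 0 * Real.exp (-(ell D ^ 10 / 8)))
        ≤ 4 * bigP D ^ 2 * (max C₁ 0 * Real.exp (-(ell D ^ 10 / 8))) :=
          mul_le_mul_of_nonneg_right hcard (mul_nonneg (le_max_right _ _) he₁)
      _ = max C₁ 0 * (4 * bigP D ^ 2 * Real.exp (-(ell D ^ 10 / 8))) := by ring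
      _ ≤ max C₁ 0 * (4 * Real.exp (-(1 / 16) * ell D ^ 10)) :=
          mul_le_mul_of_nonneg_left h2 (le_max_right _ _)
      _ = 4 * max C₁ 0 * Real.exp (-(1 / 16) * ell D ^ 10) := by ring
      _ ≤ 1 / 2 := hD3
  have b2 : 2 * (max C₂ 0 * (ell D ^ 114)⁻¹ *
      (Real.sqrt (max C₃ 0 * bigP D ^ 2 * ell D ^ 36) * Real.sqrt X * (2 * π * Real.exp (1 / 4)))) =
      2 * K * ((ell D ^ 96)⁻¹ * bigP D) * Real.sqrt X := by
    have h := lemma81Ext_sqrt_budget (le_max_right C₃ 0) hL1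
    calc 2 * (max C₂ 0 * (ell D ^ 114)⁻¹ *
          (Real.sqrt (max C₃ 0 * bigP D ^ 2 * ell D ^ 36) * Real.sqrt X * (2 * π * Real.exp (1 / 4))))
        = 2 * (max C₂ 0 * ((ell D ^ 114)⁻¹ * Real.sqrt (max C₃ 0 * bigP D ^ 2 * ell D ^ 36)) *
            Real.sqrt X * (2 * π * Real.exp (1 / 4))) := by ring
      _ = 2 * K * ((ell D ^ 96)⁻¹ * bigP D) * Real.sqrt X := by rw [h, hK]; ring
  have b3 : 2 * Real.exp (-(1 / 16) * ell D ^ 10) ≤ 1 / 2 := hD4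
  rw [b2]
  linarith

end Summit.Parity.GeneralizedHardyLittlewood.Theorems

end
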